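import Literature.AlgebraicGeometry.Resolution.ExceptionalCurvePoints
import Literature.AlgebraicGeometry.Resolution.ExceptionalPointsFinite
import HarnessLib

/-!
# `[OURS · L W4.4]` G-layer support items Gcoh and Gfin for the crux `HomologicalConductor.NoZenoR`

Crux `HomologicalConductor.NoZenoR` (stmt-ResolutionOfSingularities-19943; aside twin `NoZeno`
stmt-16483), line `sandwich-cluster`, S3 Layer 2 (G-layer).  The two SUPPORT items of the planner's
typed sketch `SketchGLayer.lean` (res-L0-w44-plan-1 g7, rev 1), with its signatures VERBATIM:

* `Gcoh_coheight_eq_one_of_mem_excCurvePoints` — on a resolution `π : X ⟶ Spec T` of a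
  two-dimensional noetherian local normal domain, every integral exceptional curve point
  `η ∈ excCurvePoints π` has `Order.coheight η = 1` (so Mathlib's `Scheme.ord _ η` is the honest
  valuation along `E_η`);
* `Gfin_excCurvePoints_finite` — `excCurvePoints π` is finite.

Both are one-line instances of the Literature glue landed with the Lipman 1969 named facts:
`IsResolution.coheight_eq_one_of_mem_excCurvePoints`, `IsResolution.excCurvePoints_subset_excPoints`
(`Literature/AlgebraicGeometry/Resolution/ExceptionalCurvePoints.lean`) and `excPoints_finite`
(`…/ExceptionalPointsFinite.lean`).  Nothing here is a statement of the manuscript under review;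
OURS; AI-written, weaker than expert review.
-/

noncomputable section

-- single-problem summit: the doubled namespace component `ResolutionOfSingularities` is forced
set_option linter.dupNamespace false

open CategoryTheory AlgebraicGeometry TopologicalSpace IsLocalRing
open Literature.AlgebraicGeometry.Resolution

namespace Summit.ResolutionOfSingularities.ResolutionOfSingularities.Theorems.NoZeno.SandwichCluster.GLayer

/-- **Gcoh** (SketchGLayer support item, signature verbatim): on a resolution `π : X ⟶ Spec T` of a
two-dimensional noetherian local normal domain, every integral exceptional curve point `η` (closed-fibre
point with one-dimensional closure, `excCurvePoints π`) has `Order.coheight η = 1`, i.e.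
`dim 𝒪_{X,η} = 1`.  From `IsResolution.coheight_eq_one_of_mem_excCurvePoints` (`height η + coheight η ≤
dim X ≤ 2`, `height η = 1`, `η` not generic); normality of `T` and the instances on `X` are idle here
and kept for the consumer's signature. [this work] -/
theorem Gcoh_coheight_eq_one_of_mem_excCurvePoints
    (T : Type) [CommRing T] [IsNoetherianRing T] [IsLocalRing T] [IsDomain T] [IsIntegrallyClosed T]
    (hT2 : ringKrullDim T = 2)
    (X : Scheme.{0}) [IsIntegral X] [IsLocallyNoetherian X] (π : X ⟶ Spec (.of T))
    (hπ : IsResolution π) :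
    ∀ η ∈ excCurvePoints π, Order.coheight η = 1 :=
  fun _ hη => hπ.coheight_eq_one_of_mem_excCurvePoints hT2 hη

/-- **Gfin** (SketchGLayer support item, signature verbatim): a resolution of a two-dimensional
noetherian local normal domain has finitely many integral exceptional curves — they are among the
finitely many maximal points of the closed fibre (`IsResolution.excCurvePoints_subset_excPoints`,
`excPoints_finite`). [this work] -/
theorem Gfin_excCurvePoints_finite
    (T : Type) [CommRing T] [IsNoetherianRing T] [IsLocalRing T] [IsDomain T] [IsIntegrallyClosed T]
    (hT2 : ringKrullDim T = 2)
    (X : Scheme.{0}) [IsIntegral X] [IsLocallyNoetherian X] (π : X ⟶ Spec (.of T))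
    (hπ : IsResolution π) :
    (excCurvePoints π).Finite := by
  haveI : IsProper π := hπ.isProper
  exact (excPoints_finite π).subset (hπ.excCurvePoints_subset_excPoints hT2)

end Summit.ResolutionOfSingularities.ResolutionOfSingularities.Theorems.NoZeno.SandwichCluster.GLayer

end
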